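import Literature.LinearAlgebra.QuadraticForm.CartanDieudonne
import Mathlib.Analysis.SpecialFunctions.SmoothTransition
import Mathlib.Analysis.SpecialFunctions.Complex.Arg
import Mathlib.Analysis.SpecialFunctions.Trigonometric.Deriv
import Mathlib.Analysis.SpecialFunctions.Sqrt
import Mathlib.Analysis.Calculus.ContDiff.FiniteDimension
import Mathlib.Analysis.Normed.Module.FiniteDimension
import Mathlib.Topology.Algebra.Module.Determinant
import Mathlib.LinearAlgebra.Matrix.Determinant.Basic
import HarnessLib

/-!
# Paths in the orthogonal group of an index-one (Lorentzian) form on a 3-space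

Topic `Literature/Topology/FourManifolds`, linear-algebra input of the frame cluster
(`FibrewiseMorseFrame*.lean`): to close an adapted frame up PERIODICALLY along a circle of
nondegenerate critical points of transverse index `1` in a `4`-manifold, the monodromy
`R ∈ O(H₀)` of the frame (an isometry of the Lorentzian fibre Hessian `H₀`, signature `(1, 2)`)
has to be joined to the identity INSIDE `O(H₀)`.  This is possible exactly when `R` lies in the
identity component `O⁺⁺ = SO⁺(1, 2)`: `det R > 0` and `R` preserves the timecones
(O'Neill, *Semi-Riemannian Geometry*, Ch. 9, Lemma 6 and Cor. 7).  This file gives the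
constructive version used by the frame files, for a symmetric bilinear form `B` on a real
`3`-space presented by a **Lorentz frame** `(v₀, b₁, b₂)` (`B`-orthonormal with signs
`(-, +, +)`, `x = -B(v₀, x) v₀ + B(b₁, x) b₁ + B(b₂, x) b₂`):

* `IndexOneForm.exists_smooth_path_of_timeconePreserving` — **main result**: if `R ∈ O(B)` has
  `det R > 0` and `B (R v₀, v₀) < 0` (O'Neill, Ch. 5, Lemma 29: `R v₀` in the timecone of `v₀`),
  there are `C^∞` maps `P, P⁻¹ : ℝ → (V →L V)`, mutually inverse, `B`-orthogonal for every
  parameter, with `P s = 1` for `s ≤ 0` and `P s = R` for `s ≥ 1`.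

The path is O'Neill's "boost, then rotation" written with reflections (tree:
`Literature.LinearAlgebra.QuadraticForm.reflection`, Iversen's `τ_n`): along the segment from
`v₀` to `R v₀` inside the timecone, normalised to unit timelike vectors `v(s)`, the product of
the two reflections along `v(s) + v₀` and `v₀` is a smooth path `Θ(s) ∈ O(B)` with
`Θ(s) v(s) = v₀`, `Θ(0) = 1`; then `Θ(1) R` fixes `v₀`, so it is a rotation of the spacelike
plane `v₀^⊥` (a rotation, not a reflection, because `det > 0` — the determinant of `Θ(1)` is
positive by continuity along the path), joined to `1` by rotations of smaller angle.

Everything here is **proved**; no definition, no named fact.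

## References

* B. O'Neill, *Semi-Riemannian Geometry with Applications to Relativity*, Academic Press
  (1983), Ch. 5, Lemma 29 (timecones); Ch. 9, "Semiorthogonal groups", Lemma 6 and Cor. 7
  (`O⁺⁺` is the identity component), pp. 233–235. [ONeill1983]
* B. Iversen, *Hyperbolic Geometry*, CUP (1992), Ch. I §2, (2.1) and Prop. 2.3 (reflections).
  [Iversen1992]
-/

noncomputable section

open Set Function Filter
open scoped Topology ContDiff
open Literature.LinearAlgebra.QuadraticForm (reflection reflection_apply reflection_apply_self
  reflection_mul_self reflection_smul isOrthogonal_reflection)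

namespace Literature.Topology.FourManifolds

namespace IndexOneForm

variable {V : Type*} [NormedAddCommGroup V] [NormedSpace ℝ V]

/-! ### Lorentz frames: coordinates and rotations of the spacelike plane -/

/-- **Coordinates in a Lorentz frame.**  If every vector expands as
`x = -B(v₀, x) v₀ + B(b₁, x) b₁ + B(b₂, x) b₂`, then
`B(x, y) = -B(v₀,x) B(v₀,y) + B(b₁,x) B(b₁,y) + B(b₂,x) B(b₂,y)`. [folklore] -/
theorem apply_eq_of_frame {B : V →L[ℝ] V →L[ℝ] ℝ} {v₀ b₁ b₂ : V}
    (hexp : ∀ x, x = (-B v₀ x) • v₀ + B b₁ x • b₁ + B b₂ x • b₂) (x y : V) :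
    B x y = -(B v₀ x * B v₀ y) + B b₁ x * B b₁ y + B b₂ x * B b₂ y := by
  conv_lhs => rw [hexp x]
  simp only [map_add, map_smul, add_apply, smul_apply, smul_eq_mul]
  ring

/-- **Pairings of a rotation of the spacelike plane with the frame.**  For the linear map
`T x = -B(v₀,x) v₀ + (c B(b₁,x) - d B(b₂,x)) b₁ + (d B(b₁,x) + c B(b₂,x)) b₂` one has
`B(v₀, T x) = B(v₀, x)`, `B(b₁, T x) = c B(b₁,x) - d B(b₂,x)`,
`B(b₂, T x) = d B(b₁,x) + c B(b₂,x)`. [folklore] -/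
theorem frame_apply_rot {B : V →L[ℝ] V →L[ℝ] ℝ} (hB : ∀ x y, B x y = B y x) {v₀ b₁ b₂ : V}
    (hv : B v₀ v₀ = -1) (h1 : B b₁ b₁ = 1) (h2 : B b₂ b₂ = 1) (h01 : B v₀ b₁ = 0)
    (h02 : B v₀ b₂ = 0) (h12 : B b₁ b₂ = 0) {c d : ℝ} {T : V →L[ℝ] V}
    (hT : ∀ x, T x = (-B v₀ x) • v₀ + (c * B b₁ x - d * B b₂ x) • b₁ +
      (d * B b₁ x + c * B b₂ x) • b₂) (x : V) :
    B v₀ (T x) = B v₀ x ∧ B b₁ (T x) = c * B b₁ x - d * B b₂ x ∧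
      B b₂ (T x) = d * B b₁ x + c * B b₂ x := by
  have h10 : B b₁ v₀ = 0 := by rw [hB, h01]
  have h20 : B b₂ v₀ = 0 := by rw [hB, h02]
  have h21 : B b₂ b₁ = 0 := by rw [hB, h12]
  refine ⟨?_, ?_, ?_⟩
  · rw [hT x]
    simp only [map_add, map_smul, smul_eq_mul, hv, h01, h02]
    ring
  · rw [hT x]
    simp only [map_add, map_smul, smul_eq_mul, h10, h1, h12]
    ring
  · rw [hT x]
    simp only [map_add, map_smul, smul_eq_mul, h20, h21, h2]
    ring

/-- **Rotations of the spacelike plane are `B`-orthogonal** (`c² + d² = 1`). [folklore] -/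
theorem isOrthogonal_rot {B : V →L[ℝ] V →L[ℝ] ℝ} (hB : ∀ x y, B x y = B y x) {v₀ b₁ b₂ : V}
    (hv : B v₀ v₀ = -1) (h1 : B b₁ b₁ = 1) (h2 : B b₂ b₂ = 1) (h01 : B v₀ b₁ = 0)
    (h02 : B v₀ b₂ = 0) (h12 : B b₁ b₂ = 0)
    (hexp : ∀ x, x = (-B v₀ x) • v₀ + B b₁ x • b₁ + B b₂ x • b₂) {c d : ℝ}
    (hcd : c ^ 2 + d ^ 2 = 1) {T : V →L[ℝ] V}
    (hT : ∀ x, T x = (-B v₀ x) • v₀ + (c * B b₁ x - d * B b₂ x) • b₁ +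
      (d * B b₁ x + c * B b₂ x) • b₂) (x y : V) :
    B (T x) (T y) = B x y := by
  obtain ⟨hx0, hx1, hx2⟩ := frame_apply_rot hB hv h1 h2 h01 h02 h12 hT x
  obtain ⟨hy0, hy1, hy2⟩ := frame_apply_rot hB hv h1 h2 h01 h02 h12 hT y
  rw [apply_eq_of_frame hexp (T x) (T y), apply_eq_of_frame hexp x y, hx0, hx1, hx2, hy0, hy1,
    hy2]
  linear_combination (B b₁ x * B b₁ y + B b₂ x * B b₂ y) * hcd

/-- **A linear map is determined by its values on the Lorentz frame**: if `S v₀ = v₀`,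
`S b₁ = c b₁ + d b₂`, `S b₂ = -d b₁ + c b₂` then `S` is the rotation with parameters `(c, d)`.
[folklore] -/
theorem apply_eq_rot_of_frame {B : V →L[ℝ] V →L[ℝ] ℝ} {v₀ b₁ b₂ : V}
    (hexp : ∀ x, x = (-B v₀ x) • v₀ + B b₁ x • b₁ + B b₂ x • b₂) {c d : ℝ} {S : V →L[ℝ] V}
    (hS0 : S v₀ = v₀) (hS1 : S b₁ = c • b₁ + d • b₂) (hS2 : S b₂ = (-d) • b₁ + c • b₂) (x : V) :
    S x = (-B v₀ x) • v₀ + (c * B b₁ x - d * B b₂ x) • b₁ + (d * B b₁ x + c * B b₂ x) • b₂ := by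
  conv_lhs => rw [hexp x]
  simp only [map_add, map_smul, hS0, hS1, hS2]
  module

/-- **Composition of rotations of the spacelike plane** is the rotation with the added angle
(`(c, d) ∘ (c', d') = (c c' - d d', c d' + d c')`). [folklore] -/
theorem rot_comp_rot {B : V →L[ℝ] V →L[ℝ] ℝ} (hB : ∀ x y, B x y = B y x) {v₀ b₁ b₂ : V}
    (hv : B v₀ v₀ = -1) (h1 : B b₁ b₁ = 1) (h2 : B b₂ b₂ = 1) (h01 : B v₀ b₁ = 0)
    (h02 : B v₀ b₂ = 0) (h12 : B b₁ b₂ = 0) {c d c' d' : ℝ} {T T' : V →L[ℝ] V}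
    (hT : ∀ x, T x = (-B v₀ x) • v₀ + (c * B b₁ x - d * B b₂ x) • b₁ +
      (d * B b₁ x + c * B b₂ x) • b₂)
    (hT' : ∀ x, T' x = (-B v₀ x) • v₀ + (c' * B b₁ x - d' * B b₂ x) • b₁ +
      (d' * B b₁ x + c' * B b₂ x) • b₂) (x : V) :
    T (T' x) = (-B v₀ x) • v₀ + ((c * c' - d * d') * B b₁ x - (c * d' + d * c') * B b₂ x) • b₁ +
      ((c * d' + d * c') * B b₁ x + (c * c' - d * d') * B b₂ x) • b₂ := by
  obtain ⟨hx0, hx1, hx2⟩ := frame_apply_rot hB hv h1 h2 h01 h02 h12 hT' x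
  rw [hT (T' x), hx0, hx1, hx2]
  match_scalars <;> ring

/-! ### Determinants -/

/-- **The determinant of a map fixing `v₀` and preserving the spacelike plane**, in a Lorentz
frame: if `S v₀ = v₀`, `S b₁ = a b₁ + b b₂`, `S b₂ = a' b₁ + b' b₂` then `det S = a b' - a' b`.
[folklore] -/
theorem det_eq_of_frame {B : V →L[ℝ] V →L[ℝ] ℝ} (hB : ∀ x y, B x y = B y x) {v₀ b₁ b₂ : V}
    (hv : B v₀ v₀ = -1) (h1 : B b₁ b₁ = 1) (h2 : B b₂ b₂ = 1) (h01 : B v₀ b₁ = 0)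
    (h02 : B v₀ b₂ = 0) (h12 : B b₁ b₂ = 0)
    (hexp : ∀ x, x = (-B v₀ x) • v₀ + B b₁ x • b₁ + B b₂ x • b₂) {a b a' b' : ℝ}
    {S : V →L[ℝ] V} (hS0 : S v₀ = v₀) (hS1 : S b₁ = a • b₁ + b • b₂)
    (hS2 : S b₂ = a' • b₁ + b' • b₂) : S.det = a * b' - a' * b := by
  have h10 : B b₁ v₀ = 0 := by rw [hB, h01]
  have h20 : B b₂ v₀ = 0 := by rw [hB, h02]
  have h21 : B b₂ b₁ = 0 := by rw [hB, h12]
  -- `(v₀, b₁, b₂)` is a basis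
  have hli : LinearIndependent ℝ ![v₀, b₁, b₂] := by
    rw [Fintype.linearIndependent_iff]
    intro g hg i
    rw [Fin.sum_univ_three] at hg
    simp only [Matrix.cons_val_zero, Matrix.cons_val_one, Matrix.cons_val] at hg
    have e0 := congrArg (fun x => B v₀ x) hg
    have e1 := congrArg (fun x => B b₁ x) hg
    have e2 := congrArg (fun x => B b₂ x) hg
    simp only [map_add, map_smul, smul_eq_mul, map_zero, hv, h01, h02, h10, h1, h12, h20, h21,
      h2] at e0 e1 e2
    fin_cases i
    · simp only [Fin.zero_eta]
      linarith
    · simp only [Fin.mk_one]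
      linarith
    · simp only [Fin.reduceFinMk]
      linarith
  have hsp : ⊤ ≤ Submodule.span ℝ (Set.range ![v₀, b₁, b₂]) := by
    intro x _
    rw [hexp x]
    refine Submodule.add_mem _ (Submodule.add_mem _ (Submodule.smul_mem _ _ ?_)
      (Submodule.smul_mem _ _ ?_)) (Submodule.smul_mem _ _ ?_)
    · exact Submodule.subset_span ⟨0, rfl⟩
    · exact Submodule.subset_span ⟨1, rfl⟩
    · exact Submodule.subset_span ⟨2, rfl⟩
  set e : Module.Basis (Fin 3) ℝ V := Module.Basis.mk hli hsp with he
  have he0 : e 0 = v₀ := by rw [he, Module.Basis.mk_apply]; rfl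
  have he1 : e 1 = b₁ := by rw [he, Module.Basis.mk_apply]; rfl
  have he2 : e 2 = b₂ := by rw [he, Module.Basis.mk_apply]; rfl
  -- the matrix of `S`
  have hr0 : e.repr (S (e 0)) = Finsupp.single 0 1 := by
    rw [he0, hS0, ← he0, e.repr_self]
  have hr1 : e.repr (S (e 1)) = a • Finsupp.single 1 1 + b • Finsupp.single 2 1 := by
    rw [he1, hS1, ← he1, ← he2, map_add, map_smul, map_smul, e.repr_self, e.repr_self]
  have hr2 : e.repr (S (e 2)) = a' • Finsupp.single 1 1 + b' • Finsupp.single 2 1 := by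
    rw [he2, hS2, ← he1, ← he2, map_add, map_smul, map_smul, e.repr_self, e.repr_self]
  have hM : LinearMap.toMatrix e e (S : V →ₗ[ℝ] V) = !![1, 0, 0; 0, a, a'; 0, b, b'] := by
    ext i j
    rw [LinearMap.toMatrix_apply, ContinuousLinearMap.coe_coe]
    fin_cases i <;> fin_cases j <;> simp [hr0, hr1, hr2]
  rw [ContinuousLinearMap.det, ← LinearMap.det_toMatrix e, hM, Matrix.det_fin_three]
  simp

/-- **The determinant stays positive along a path of invertible maps** starting at a map of
positive determinant (continuity of `det` and the intermediate value theorem). [folklore] -/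
theorem det_pos_of_continuousOn {P Pinv : ℝ → (V →L[ℝ] V)} {s₀ s₁ : ℝ} (hs : s₀ ≤ s₁)
    (hP : ContinuousOn P (Icc s₀ s₁)) (hinv : ∀ s ∈ Icc s₀ s₁, ∀ x, P s (Pinv s x) = x)
    (h0 : 0 < (P s₀).det) : 0 < (P s₁).det := by
  have hne : ∀ s ∈ Icc s₀ s₁, (P s).det ≠ 0 := fun s hs h => by
    have hc : (P s).comp (Pinv s) = ContinuousLinearMap.id ℝ V :=
      ContinuousLinearMap.ext fun x => by simp [hinv s hs x]
    have hd : ((P s).comp (Pinv s)).det = (P s).det * (Pinv s).det := by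
      unfold ContinuousLinearMap.det
      exact LinearMap.det_comp _ _
    have hid : (ContinuousLinearMap.id ℝ V).det = 1 := by
      unfold ContinuousLinearMap.det
      exact LinearMap.det_id
    rw [hc, hid, h, zero_mul] at hd
    exact one_ne_zero hd
  have hcont : ContinuousOn (fun s => (P s).det) (Icc s₀ s₁) :=
    ContinuousLinearMap.continuous_det.comp_continuousOn hP
  by_contra hneg
  have hle : (P s₁).det ≤ 0 := not_lt.1 hneg
  obtain ⟨s, hs', hszero⟩ :=
    intermediate_value_Icc' hs hcont ⟨hle, h0.le⟩
  exact hne s hs' hszero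

/-! ### Reflections and the two-reflection boost -/

/-- **Reflections depend smoothly on a non-isotropic vector**: for a `C^∞` curve `n` with
`B(n, n) ≠ 0` the reflections `τ_{n(s)}` form a `C^∞` curve of continuous linear maps.
[folklore] -/
theorem contDiff_reflection [FiniteDimensional ℝ V] (B : V →L[ℝ] V →L[ℝ] ℝ) {n : ℝ → V}
    (hn : ContDiff ℝ ∞ n) (hiso : ∀ s, B (n s) (n s) ≠ 0) :
    ContDiff ℝ ∞ fun s => LinearMap.toContinuousLinearMap (reflection B.toBilinForm (n s)) := by
  refine contDiff_clm_apply_iff.2 fun x => ?_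
  have hform : (fun s => LinearMap.toContinuousLinearMap (reflection B.toBilinForm (n s)) x) =
      fun s => x - (2 / B (n s) (n s) * B (n s) x) • n s := by
    funext s
    rw [LinearMap.coe_toContinuousLinearMap', reflection_apply]
    rfl
  rw [hform]
  have hBn : ContDiff ℝ ∞ fun s => B (n s) := B.contDiff.comp hn
  exact contDiff_const.sub (((contDiff_const.div (hBn.clm_apply hn) hiso).mul
    (hBn.clm_apply contDiff_const)).smul hn)

/-- **Two reflections move a unit timelike vector to another one in its timecone**: for
`B(v, v) = B(v₀, v₀) = -1` with `B(v, v₀) ≠ 1`, the reflection along `v + v₀` maps `v` to `-v₀`,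
and the reflection along `v₀` then maps `-v₀` to `v₀` (Iversen, Prop. 2.3). [cite: Iversen1992,
Ch. I §2, Prop. 2.3] -/
theorem reflection_reflection_apply_eq {B : V →L[ℝ] V →L[ℝ] ℝ} (hB : ∀ x y, B x y = B y x)
    {v v₀ : V} (hv : B v v = -1) (hv₀ : B v₀ v₀ = -1) (hvv₀ : B v v₀ ≠ 1) :
    reflection B.toBilinForm v₀ (reflection B.toBilinForm (v + v₀) v) = v₀ := by
  have hv₀v : B v₀ v = B v v₀ := hB v₀ v
  have hnn : B.toBilinForm (v + v₀) (v + v₀) = 2 * (B v v₀ - 1) := by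
    simp only [map_add, LinearMap.add_apply, ContinuousLinearMap.toBilinForm_apply, hv, hv₀,
      hv₀v]
    ring
  have hnv : B.toBilinForm (v + v₀) v = B v v₀ - 1 := by
    simp only [map_add, LinearMap.add_apply, ContinuousLinearMap.toBilinForm_apply, hv, hv₀v]
    ring
  have hne : B v v₀ - 1 ≠ 0 := sub_ne_zero.2 hvv₀
  have h1 : reflection B.toBilinForm (v + v₀) v = -v₀ := by
    rw [reflection_apply, hnn, hnv]
    have : 2 / (2 * (B v v₀ - 1)) * (B v v₀ - 1) = 1 := by
      field_simp
    rw [this, one_smul]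
    abel
  have hv₀' : B.toBilinForm v₀ v₀ ≠ 0 := by
    rw [ContinuousLinearMap.toBilinForm_apply, hv₀]
    norm_num
  rw [h1, map_neg, reflection_apply_self B.toBilinForm hv₀', neg_neg]

/-! ### The two-reflection boost along the segment in the timecone -/

/-- **The boost path.**  For unit timelike `v₀`, `w` in the same timecone (`B(w, v₀) < 0`) there
are `C^∞` maps `Θ, Θ⁻¹ : ℝ → (V →L V)`, inverse to each other, `B`-orthogonal, equal to `1`
for `s ≤ 0`, constant for `s ≥ 1`, with `Θ(1) w = v₀` and `det Θ(1) > 0`: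
`Θ(s) = τ_{v₀} ∘ τ_{v(s) + v₀}` with `v(s)` the unit timelike vector on the segment from `v₀`
to `w` at parameter `Real.smoothTransition s` (timecones are convex, O'Neill, Ch. 5, after
Lemma 29). [cite: ONeill1983, Ch. 5, Lemma 29] [cite: Iversen1992, Ch. I §2, Prop. 2.3] -/
theorem exists_smooth_boost [FiniteDimensional ℝ V] {B : V →L[ℝ] V →L[ℝ] ℝ}
    (hB : ∀ x y, B x y = B y x) {v₀ w : V} (hv : B v₀ v₀ = -1) (hww : B w w = -1)
    (hcone : B w v₀ < 0) :
    ∃ Θ Θi : ℝ → (V →L[ℝ] V), ContDiff ℝ ∞ Θ ∧ ContDiff ℝ ∞ Θi ∧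
      (∀ s ≤ 0, Θ s = ContinuousLinearMap.id ℝ V) ∧
      (∀ s ≤ 0, Θi s = ContinuousLinearMap.id ℝ V) ∧
      (∀ s, 1 ≤ s → Θ s = Θ 1) ∧ (∀ s, 1 ≤ s → Θi s = Θi 1) ∧ Θ 1 w = v₀ ∧
      (∀ s x, Θ s (Θi s x) = x) ∧ (∀ s x, Θi s (Θ s x) = x) ∧
      (∀ s x y, B (Θ s x) (Θ s y) = B x y) ∧ (∀ s x y, B (Θi s x) (Θi s y) = B x y) ∧
      0 < (Θ 1).det := by
  have hBbs : B.toBilinForm.IsSymm := ⟨fun x y => hB x y⟩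
  -- reflections as continuous linear maps
  obtain ⟨ρ, hρ_eq⟩ : ∃ ρ : V → (V →L[ℝ] V),
      ∀ n, ρ n = LinearMap.toContinuousLinearMap (reflection B.toBilinForm n) := ⟨_, fun n => rfl⟩
  have hρ_apply : ∀ n x, ρ n x = reflection B.toBilinForm n x := fun n x => by rw [hρ_eq]; rfl
  have hρO : ∀ n x y, B (ρ n x) (ρ n y) = B x y := fun n x y => by
    rw [hρ_apply, hρ_apply]
    exact isOrthogonal_reflection hBbs n x y
  have hρρ : ∀ n x, ρ n (ρ n x) = x := fun n x => by
    rw [hρ_apply, hρ_apply]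
    show (reflection B.toBilinForm n * reflection B.toBilinForm n) x = x
    rw [reflection_mul_self]
    rfl
  have hρv₀v₀ : ∀ x, ρ ((2 : ℝ) • v₀) (ρ v₀ x) = x := fun x => by
    rw [hρ_apply, hρ_apply, reflection_smul B.toBilinForm (two_ne_zero : (2 : ℝ) ≠ 0)]
    show (reflection B.toBilinForm v₀ * reflection B.toBilinForm v₀) x = x
    rw [reflection_mul_self]
    rfl
  have hρv₀v₀' : ∀ x, ρ v₀ (ρ ((2 : ℝ) • v₀) x) = x := fun x => by
    rw [hρ_apply, hρ_apply, reflection_smul B.toBilinForm (two_ne_zero : (2 : ℝ) ≠ 0)]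
    show (reflection B.toBilinForm v₀ * reflection B.toBilinForm v₀) x = x
    rw [reflection_mul_self]
    rfl
  -- the parameter `σ` and the segment `u s = (1 - σ s) v₀ + σ s w`
  have hv₀w : B v₀ w < 0 := by rw [hB]; exact hcone
  have hσs : ContDiff ℝ ∞ Real.smoothTransition := Real.smoothTransition.contDiff
  have hσnn : ∀ s, 0 ≤ Real.smoothTransition s := fun s => Real.smoothTransition.nonneg s
  have hσle : ∀ s, Real.smoothTransition s ≤ 1 := fun s => Real.smoothTransition.le_one s
  obtain ⟨u, hu⟩ : ∃ u : ℝ → V, ∀ s,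
      u s = (1 - Real.smoothTransition s) • v₀ + Real.smoothTransition s • w := ⟨_, fun s => rfl⟩
  have hus : ContDiff ℝ ∞ u := by
    rw [show u = _ from funext hu]
    exact ((contDiff_const.sub hσs).smul contDiff_const).add (hσs.smul contDiff_const)
  have huu_le : ∀ s, B (u s) (u s) ≤ -(1 / 2) := fun s => by
    have h : B (u s) (u s) = -(1 - Real.smoothTransition s) ^ 2 - Real.smoothTransition s ^ 2 +
        2 * (Real.smoothTransition s * (1 - Real.smoothTransition s)) * B v₀ w := by
      simp only [hu, map_add, map_smul, add_apply, smul_apply, smul_eq_mul, hv, hww, hB w v₀]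
      ring
    rw [h]
    nlinarith [sq_nonneg (Real.smoothTransition s - 1 / 2),
      mul_nonneg (mul_nonneg (hσnn s) (sub_nonneg.2 (hσle s))) (neg_nonneg.2 hv₀w.le)]
  have huv₀_neg : ∀ s, B (u s) v₀ < 0 := fun s => by
    have h : B (u s) v₀ = -(1 - Real.smoothTransition s) + Real.smoothTransition s * B w v₀ := by
      simp only [hu, map_add, map_smul, add_apply, smul_apply, smul_eq_mul, hv]
      ring
    rw [h]
    rcases eq_or_lt_of_le (hσnn s) with h' | h'
    · rw [← h']
      norm_num
    · nlinarith [hσle s, hcone]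
  -- the unit timelike vectors `v s = u s / √(-B (u s, u s))`
  obtain ⟨q, hq⟩ : ∃ q : ℝ → ℝ, ∀ s, q s = Real.sqrt (-B (u s) (u s)) := ⟨_, fun s => rfl⟩
  have hq_pos : ∀ s, 0 < q s := fun s => by
    rw [hq]
    exact Real.sqrt_pos.2 (by linarith [huu_le s])
  have hq_sq : ∀ s, q s ^ 2 = -B (u s) (u s) := fun s => by
    rw [hq]
    exact Real.sq_sqrt (by linarith [huu_le s])
  have hqs : ContDiff ℝ ∞ q := by
    rw [show q = _ from funext hq]
    exact ((B.contDiff.comp hus).clm_apply hus).neg.sqrt fun s =>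
      (by linarith [huu_le s] : -B (u s) (u s) ≠ 0)
  obtain ⟨v, hvq⟩ : ∃ v : ℝ → V, ∀ s, v s = (q s)⁻¹ • u s := ⟨_, fun s => rfl⟩
  have hvs : ContDiff ℝ ∞ v := by
    rw [show v = _ from funext hvq]
    exact (hqs.inv fun s => (hq_pos s).ne').smul hus
  have hvv : ∀ s, B (v s) (v s) = -1 := fun s => by
    simp only [hvq, map_smul, smul_apply, smul_eq_mul]
    have hq0 : q s ≠ 0 := (hq_pos s).ne'
    have hb : B (u s) (u s) = -(q s ^ 2) := by linarith [hq_sq s]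
    rw [hb]
    field_simp
  have hvv₀ : ∀ s, B (v s) v₀ < 0 := fun s => by
    rw [hvq, map_smul, smul_apply, smul_eq_mul]
    exact mul_neg_of_pos_of_neg (inv_pos.2 (hq_pos s)) (huv₀_neg s)
  have hv_of_σ0 : ∀ s, Real.smoothTransition s = 0 → v s = v₀ := fun s hs => by
    have hu0 : u s = v₀ := by rw [hu, hs]; simp
    have hq1 : q s = 1 := by rw [hq, hu0, hv, neg_neg, Real.sqrt_one]
    rw [hvq, hq1, hu0, inv_one, one_smul]
  have hv_of_σ1 : ∀ s, Real.smoothTransition s = 1 → v s = w := fun s hs => by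
    have hu1 : u s = w := by rw [hu, hs]; simp
    have hq1 : q s = 1 := by rw [hq, hu1, hww, neg_neg, Real.sqrt_one]
    rw [hvq, hq1, hu1, inv_one, one_smul]
  -- the moving reflection vector `v s + v₀` is uniformly non-isotropic
  have hnn_ne : ∀ s, B (v s + v₀) (v s + v₀) ≠ 0 := fun s => by
    have h : B (v s + v₀) (v s + v₀) = 2 * (B (v s) v₀ - 1) := by
      simp only [map_add, add_apply, hvv, hv, hB v₀ (v s)]
      ring
    rw [h]
    nlinarith [hvv₀ s]
  have hρs : ContDiff ℝ ∞ fun s => ρ (v s + v₀) := by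
    simp only [hρ_eq]
    exact contDiff_reflection B (hvs.add contDiff_const) hnn_ne
  -- `Θ s = τ_{v₀} ∘ τ_{v s + v₀}`
  refine ⟨fun s => (ρ v₀).comp (ρ (v s + v₀)), fun s => (ρ (v s + v₀)).comp (ρ v₀),
    contDiff_const.clm_comp hρs, hρs.clm_comp contDiff_const, fun s hs => ?_, fun s hs => ?_,
    fun s hs => ?_, fun s hs => ?_, ?_, fun s x => ?_, fun s x => ?_, fun s x y => ?_,
    fun s x y => ?_, ?_⟩
  · ext x
    show ρ v₀ (ρ (v s + v₀) x) = x
    rw [hv_of_σ0 s (Real.smoothTransition.zero_of_nonpos hs), ← two_smul ℝ v₀, hρv₀v₀']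
  · ext x
    show ρ (v s + v₀) (ρ v₀ x) = x
    rw [hv_of_σ0 s (Real.smoothTransition.zero_of_nonpos hs), ← two_smul ℝ v₀, hρv₀v₀]
  · show (ρ v₀).comp (ρ (v s + v₀)) = (ρ v₀).comp (ρ (v 1 + v₀))
    rw [hv_of_σ1 s (Real.smoothTransition.one_of_one_le hs),
      hv_of_σ1 1 (Real.smoothTransition.one_of_one_le le_rfl)]
  · show (ρ (v s + v₀)).comp (ρ v₀) = (ρ (v 1 + v₀)).comp (ρ v₀)
    rw [hv_of_σ1 s (Real.smoothTransition.one_of_one_le hs),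
      hv_of_σ1 1 (Real.smoothTransition.one_of_one_le le_rfl)]
  · show ρ v₀ (ρ (v 1 + v₀) w) = v₀
    have h1 : v 1 = w := hv_of_σ1 1 (Real.smoothTransition.one_of_one_le le_rfl)
    rw [hρ_apply, hρ_apply]
    conv_lhs => rw [← h1]
    exact reflection_reflection_apply_eq hB (hvv 1) hv ((hvv₀ 1).trans zero_lt_one).ne
  · show ρ v₀ (ρ (v s + v₀) (ρ (v s + v₀) (ρ v₀ x))) = x
    rw [hρρ, hρρ]
  · show ρ (v s + v₀) (ρ v₀ (ρ v₀ (ρ (v s + v₀) x))) = x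
    rw [hρρ, hρρ]
  · show B (ρ v₀ (ρ (v s + v₀) x)) (ρ v₀ (ρ (v s + v₀) y)) = B x y
    rw [hρO, hρO]
  · show B (ρ (v s + v₀) (ρ v₀ x)) (ρ (v s + v₀) (ρ v₀ y)) = B x y
    rw [hρO, hρO]
  · -- positivity of the determinant at `s = 1`, by continuity from `Θ 0 = 1`
    have hid : (ContinuousLinearMap.id ℝ V).det = 1 := by
      unfold ContinuousLinearMap.det
      exact LinearMap.det_id
    have h0 : (fun s : ℝ => (ρ v₀).comp (ρ (v s + v₀))) 0 = ContinuousLinearMap.id ℝ V := by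
      ext x
      show ρ v₀ (ρ (v 0 + v₀) x) = x
      rw [hv_of_σ0 0 (Real.smoothTransition.zero_of_nonpos le_rfl), ← two_smul ℝ v₀, hρv₀v₀']
    have h0' : 0 < ((fun s : ℝ => (ρ v₀).comp (ρ (v s + v₀))) 0).det := by
      rw [h0, hid]
      exact one_pos
    exact det_pos_of_continuousOn (P := fun s : ℝ => (ρ v₀).comp (ρ (v s + v₀)))
      (Pinv := fun s => (ρ (v s + v₀)).comp (ρ v₀)) zero_le_one
      (contDiff_const.clm_comp hρs).continuous.continuousOn
      (fun s _ x => show ρ v₀ (ρ (v s + v₀) (ρ (v s + v₀) (ρ v₀ x))) = x by rw [hρρ, hρρ]) h0'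

/-! ### Rotations of the spacelike plane: the path from `1` to a rotation -/

/-- **The rotation path.**  If `S ∈ O(B)` fixes `v₀` and has `det S > 0`, then in the Lorentz
frame `S` is the rotation of the spacelike plane `v₀^⊥` by some angle `α`, and
`s ↦ Rot(σ(s) α)` (`σ = Real.smoothTransition`) is a `C^∞` path in `O(B)` from `1` (`s ≤ 0`)
to `S` (`s ≥ 1`), with inverse path `Rot(-σ(s) α)`. [folklore] -/
theorem exists_smooth_path_of_apply_eq [FiniteDimensional ℝ V] {B : V →L[ℝ] V →L[ℝ] ℝ}
    (hB : ∀ x y, B x y = B y x) {v₀ b₁ b₂ : V}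
    (hv : B v₀ v₀ = -1) (h1 : B b₁ b₁ = 1) (h2 : B b₂ b₂ = 1) (h01 : B v₀ b₁ = 0)
    (h02 : B v₀ b₂ = 0) (h12 : B b₁ b₂ = 0)
    (hexp : ∀ x, x = (-B v₀ x) • v₀ + B b₁ x • b₁ + B b₂ x • b₂)
    {S : V →L[ℝ] V} (hSO : ∀ x y, B (S x) (S y) = B x y) (hSv₀ : S v₀ = v₀)
    (hdet : 0 < S.det) :
    ∃ Q Qinv : ℝ → (V →L[ℝ] V), ContDiff ℝ ∞ Q ∧ ContDiff ℝ ∞ Qinv ∧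
      (∀ s ≤ 0, Q s = ContinuousLinearMap.id ℝ V) ∧ (∀ s, 1 ≤ s → Q s = S) ∧
      (∀ s x, Q s (Qinv s x) = x) ∧ (∀ s x, Qinv s (Q s x) = x) ∧
      ∀ s x y, B (Q s x) (Q s y) = B x y := by
  have h21 : B b₂ b₁ = 0 := by rw [hB, h12]
  -- `S` in the Lorentz frame
  have hSb₁v₀ : B v₀ (S b₁) = 0 := by
    have h := hSO v₀ b₁
    rw [hSv₀] at h
    rw [h, h01]
  have hSb₂v₀ : B v₀ (S b₂) = 0 := by
    have h := hSO v₀ b₂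
    rw [hSv₀] at h
    rw [h, h02]
  obtain ⟨a, b, hSb₁⟩ : ∃ a b : ℝ, S b₁ = a • b₁ + b • b₂ := by
    refine ⟨B b₁ (S b₁), B b₂ (S b₁), ?_⟩
    have h := hexp (S b₁)
    rwa [hSb₁v₀, neg_zero, zero_smul, zero_add] at h
  obtain ⟨a', b', hSb₂⟩ : ∃ a' b' : ℝ, S b₂ = a' • b₁ + b' • b₂ := by
    refine ⟨B b₁ (S b₂), B b₂ (S b₂), ?_⟩
    have h := hexp (S b₂)
    rwa [hSb₂v₀, neg_zero, zero_smul, zero_add] at h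
  have hpair : ∀ c d c' d' : ℝ, B (c • b₁ + d • b₂) (c' • b₁ + d' • b₂) = c * c' + d * d' := by
    intro c d c' d'
    simp only [map_add, map_smul, add_apply, smul_apply, smul_eq_mul, h1, h2, h12, h21]
    ring
  have hab : a ^ 2 + b ^ 2 = 1 := by
    have h := hSO b₁ b₁
    rw [hSb₁, h1, hpair] at h
    nlinarith [h]
  have hab' : a' ^ 2 + b' ^ 2 = 1 := by
    have h := hSO b₂ b₂
    rw [hSb₂, h2, hpair] at h
    nlinarith [h]
  have habab' : a * a' + b * b' = 0 := by
    have h := hSO b₁ b₂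
    rw [hSb₁, hSb₂, h12, hpair] at h
    linarith [h]
  have hdet_eq : S.det = a * b' - a' * b :=
    det_eq_of_frame hB hv h1 h2 h01 h02 h12 hexp hSv₀ hSb₁ hSb₂
  have hμ : a * b' - a' * b = 1 := by
    have hpos : 0 < a * b' - a' * b := hdet_eq ▸ hdet
    have hsq : (a * b' - a' * b) ^ 2 = 1 := by
      have : (a * b' - a' * b) ^ 2 =
          (a ^ 2 + b ^ 2) * (a' ^ 2 + b' ^ 2) - (a * a' + b * b') ^ 2 := by ring
      rw [this, hab, hab', habab']
      ring
    nlinarith [hsq, hpos]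
  have ha' : a' = -b := by linear_combination (-a') * hab + (-b) * hμ + a * habab'
  have hb' : b' = a := by linear_combination (-b') * hab + a * hμ + b * habab'
  -- the angle
  obtain ⟨α, hcos, hsin⟩ : ∃ α : ℝ, Real.cos α = a ∧ Real.sin α = b := by
    obtain ⟨z, hz⟩ : ∃ z : ℂ, z = ⟨a, b⟩ := ⟨_, rfl⟩
    have hnorm : ‖z‖ = 1 := by
      have h2' : ‖z‖ ^ 2 = 1 := by
        rw [hz, Complex.sq_norm, Complex.normSq_mk]
        nlinarith [hab]
      exact (pow_eq_one_iff_of_nonneg (norm_nonneg z) two_ne_zero).1 h2'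
    have hz0 : z ≠ 0 := by
      intro h
      rw [h, norm_zero] at hnorm
      exact zero_ne_one hnorm
    refine ⟨Complex.arg z, ?_, ?_⟩
    · rw [Complex.cos_arg hz0, hnorm, div_one, hz]
    · rw [Complex.sin_arg, hnorm, div_one, hz]
  -- rotations of the spacelike plane
  obtain ⟨Rot, hRot_eq⟩ : ∃ Rot : ℝ → (V →L[ℝ] V), ∀ θ, Rot θ =
      -((B v₀).smulRight v₀) + (Real.cos θ • B b₁ - Real.sin θ • B b₂).smulRight b₁ +
        (Real.sin θ • B b₁ + Real.cos θ • B b₂).smulRight b₂ := ⟨_, fun θ => rfl⟩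
  have hRot_apply : ∀ θ x, Rot θ x = (-B v₀ x) • v₀ +
      (Real.cos θ * B b₁ x - Real.sin θ * B b₂ x) • b₁ +
      (Real.sin θ * B b₁ x + Real.cos θ * B b₂ x) • b₂ := fun θ x => by
    simp only [hRot_eq, add_apply, neg_apply, sub_apply, smul_apply,
      ContinuousLinearMap.smulRight_apply, smul_eq_mul, neg_smul]
  have hRotO : ∀ θ x y, B (Rot θ x) (Rot θ y) = B x y := fun θ =>
    isOrthogonal_rot hB hv h1 h2 h01 h02 h12 hexp (Real.cos_sq_add_sin_sq θ) (hRot_apply θ)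
  have hRot0 : Rot 0 = ContinuousLinearMap.id ℝ V := by
    ext x
    rw [hRot_apply, Real.cos_zero, Real.sin_zero, one_mul, zero_mul, sub_zero, zero_mul,
      one_mul, zero_add]
    exact (hexp x).symm
  have hRotRot : ∀ θ x, Rot θ (Rot (-θ) x) = x := fun θ x => by
    have hc : Real.cos θ * Real.cos (-θ) - Real.sin θ * Real.sin (-θ) = 1 := by
      rw [Real.cos_neg, Real.sin_neg]
      nlinarith [Real.cos_sq_add_sin_sq θ]
    have hs' : Real.cos θ * Real.sin (-θ) + Real.sin θ * Real.cos (-θ) = 0 := by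
      rw [Real.cos_neg, Real.sin_neg]
      ring
    rw [rot_comp_rot hB hv h1 h2 h01 h02 h12 (hRot_apply θ) (hRot_apply (-θ)), hc, hs', one_mul,
      zero_mul, sub_zero, zero_mul, one_mul, zero_add]
    exact (hexp x).symm
  have hRotα : Rot α = S := by
    ext x
    rw [hRot_apply, hcos, hsin]
    exact (apply_eq_rot_of_frame hexp hSv₀ hSb₁ (by rw [hSb₂, ha', hb']) x).symm
  have hRotf : ∀ {f : ℝ → ℝ}, ContDiff ℝ ∞ f → ContDiff ℝ ∞ fun s => Rot (f s) := by
    intro f hf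
    refine contDiff_clm_apply_iff.2 fun x => ?_
    have hform : (fun s => Rot (f s) x) = fun s => (-B v₀ x) • v₀ +
        (Real.cos (f s) * B b₁ x - Real.sin (f s) * B b₂ x) • b₁ +
        (Real.sin (f s) * B b₁ x + Real.cos (f s) * B b₂ x) • b₂ :=
      funext fun s => hRot_apply (f s) x
    rw [hform]
    have hc : ContDiff ℝ ∞ fun s => Real.cos (f s) := Real.contDiff_cos.comp hf
    have hs' : ContDiff ℝ ∞ fun s => Real.sin (f s) := Real.contDiff_sin.comp hf
    exact (contDiff_const.add (((hc.mul contDiff_const).sub (hs'.mul contDiff_const)).smul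
      contDiff_const)).add (((hs'.mul contDiff_const).add (hc.mul contDiff_const)).smul
      contDiff_const)
  have hσs : ContDiff ℝ ∞ fun s => Real.smoothTransition s * α :=
    Real.smoothTransition.contDiff.mul contDiff_const
  refine ⟨fun s => Rot (Real.smoothTransition s * α), fun s => Rot (-(Real.smoothTransition s * α)),
    hRotf hσs, hRotf hσs.neg, fun s hs => ?_, fun s hs => ?_, fun s x => hRotRot _ x,
    fun s x => ?_, fun s x y => hRotO _ x y⟩
  · show Rot (Real.smoothTransition s * α) = ContinuousLinearMap.id ℝ V
    rw [Real.smoothTransition.zero_of_nonpos hs, zero_mul, hRot0]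
  · show Rot (Real.smoothTransition s * α) = S
    rw [Real.smoothTransition.one_of_one_le hs, one_mul, hRotα]
  · have h := hRotRot (-(Real.smoothTransition s * α)) x
    rwa [neg_neg] at h

/-! ### The path from `1` to a timecone-preserving isometry of positive determinant -/

/-- **A timecone-preserving isometry of positive determinant is joined to the identity inside
the orthogonal group** (constructive form of O'Neill, Ch. 9, Lemma 6 and Cor. 7 for `O(1, 2)`).
Let `B` be a symmetric bilinear form on a finite-dimensional real space presented by a Lorentz
frame `(v₀, b₁, b₂)`, and `R ∈ O(B)` with `det R > 0` and `B (R v₀, v₀) < 0` (i.e. `R v₀` lies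
in the timecone of `v₀`, O'Neill, Ch. 5, Lemma 29).  Then there are `C^∞` maps
`P, P⁻¹ : ℝ → (V →L V)`, inverse to each other and `B`-orthogonal for every parameter, with
`P s = 1` for `s ≤ 0` and `P s = R` for `s ≥ 1`: `P(s) = Θ(s)⁻¹ ∘ Q(s)` with the boost path
`Θ` of `exists_smooth_boost` (`Θ(1) R v₀ = v₀`) and the rotation path `Q` from `1` to
`Θ(1) ∘ R` of `exists_smooth_path_of_apply_eq`.
[cite: ONeill1983, Ch. 9, Lemma 6 and Cor. 7; Ch. 5, Lemma 29]
[cite: Iversen1992, Ch. I §2, Prop. 2.3] -/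
theorem exists_smooth_path_of_timeconePreserving [FiniteDimensional ℝ V]
    {B : V →L[ℝ] V →L[ℝ] ℝ} (hB : ∀ x y, B x y = B y x) {v₀ b₁ b₂ : V}
    (hv : B v₀ v₀ = -1) (h1 : B b₁ b₁ = 1) (h2 : B b₂ b₂ = 1) (h01 : B v₀ b₁ = 0)
    (h02 : B v₀ b₂ = 0) (h12 : B b₁ b₂ = 0)
    (hexp : ∀ x, x = (-B v₀ x) • v₀ + B b₁ x • b₁ + B b₂ x • b₂)
    {R : V →L[ℝ] V} (hRO : ∀ x y, B (R x) (R y) = B x y) (hdet : 0 < R.det)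
    (hcone : B (R v₀) v₀ < 0) :
    ∃ P Pinv : ℝ → (V →L[ℝ] V), ContDiff ℝ ∞ P ∧ ContDiff ℝ ∞ Pinv ∧
      (∀ s ≤ 0, P s = ContinuousLinearMap.id ℝ V) ∧ (∀ s, 1 ≤ s → P s = R) ∧
      (∀ s x, P s (Pinv s x) = x) ∧ (∀ s x, Pinv s (P s x) = x) ∧
      ∀ s x y, B (P s x) (P s y) = B x y := by
  have hww : B (R v₀) (R v₀) = -1 := by rw [hRO, hv]
  obtain ⟨Θ, Θi, hΘs, hΘis, hΘ0, hΘi0, hΘ1, hΘi1, hΘw, hΘΘi, hΘiΘ, hΘO, hΘiO, hΘdet⟩ :=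
    exists_smooth_boost hB hv hww hcone
  -- `S = Θ 1 ∘ R` fixes `v₀`
  have hSO : ∀ x y, B (((Θ 1).comp R) x) (((Θ 1).comp R) y) = B x y := fun x y => by
    show B (Θ 1 (R x)) (Θ 1 (R y)) = B x y
    rw [hΘO, hRO]
  have hSdet : 0 < ((Θ 1).comp R).det := by
    have hmul : ((Θ 1).comp R).det = (Θ 1).det * R.det := by
      unfold ContinuousLinearMap.det
      exact LinearMap.det_comp _ _
    rw [hmul]
    exact mul_pos hΘdet hdet
  obtain ⟨Q, Qinv, hQs, hQinvs, hQ0, hQ1, hQQi, hQiQ, hQO⟩ :=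
    exists_smooth_path_of_apply_eq hB hv h1 h2 h01 h02 h12 hexp hSO hΘw hSdet
  refine ⟨fun s => (Θi s).comp (Q s), fun s => (Qinv s).comp (Θ s), hΘis.clm_comp hQs,
    hQinvs.clm_comp hΘs, fun s hs => ?_, fun s hs => ?_, fun s x => ?_, fun s x => ?_,
    fun s x y => ?_⟩
  · show (Θi s).comp (Q s) = ContinuousLinearMap.id ℝ V
    rw [hΘi0 s hs, hQ0 s hs]
    rfl
  · show (Θi s).comp (Q s) = R
    rw [hΘi1 s hs, hQ1 s hs]
    ext x
    exact hΘiΘ 1 (R x)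
  · show Θi s (Q s (Qinv s (Θ s x))) = x
    rw [hQQi, hΘiΘ]
  · show Qinv s (Θ s (Θi s (Q s x))) = x
    rw [hΘΘi, hQiQ]
  · show B (Θi s (Q s x)) (Θi s (Q s y)) = B x y
    rw [hΘiO, hQO]

end IndexOneForm

end Literature.Topology.FourManifolds
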